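import Summits.BirchSwinnertonDyer.BirchSwinnertonDyer.Theorems.SignedLowerHalvesSmallImageLowerHalfBothSignsMuRiderParitySpanThree
import HarnessLib

/-!
# Route `SignedLowerHalves`, child crux L `SmallImageLowerHalfBothSigns` (item stmt-BirchSwinnertonDyer-23599), line
# `birth_acns` v14, stub `stub_muBothSigns_ns`: the PARITY-SPAN ROAD at `p = 3`, part 4b — HALVES ⟹ SIGNS, the node, and
# the registered stub's text from PARITY-SPAN(3) ∧ the node at `p ≥ 5` (cell `bsd-ssimc`, width seat `bsd-line-slh-p3-w2`
# gen 3 under LEAD slh-p3; helper `--supports 23599`; THEOREMS ONLY; continues `…MuRiderParitySpanThree.lean`, same namespace)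

HONEST FRAMING.  Child L, crux 4, the stub and BSD are OPEN and NOT proved by anything here; no definition, no named fact,
no `sorry`.  DISPLAYED antecedents: the two parity halves `SpanModBy N 3 {γ | IsGoodAt (3²) γ}` (even layers) and
`SpanModBy N 3 {γ | ∃ k, |d_γ| = 3^{2k+1}}` (odd layers) of THEOREM B's generating set (part 4a), read at the level of a newform;
the class-wide PARITY-SPAN(3) := «both halves at every level `M ≥ 1` prime to `3`» (OPEN; implied by Sun 2007 Conj. 8 at `(3,3)`
/ LS-0(3); a HYPOTHESIS); the conjecture node `SignedMuVanishing W p`.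

* §1 (`p = 3` good, `a₃ = 0`, `f` any newform of `W`, any Sprung = Pollack pair): EVEN HALF ⟹ `L♯ = L⁺ = kobayashiL (−1)` has
  unit content (`μ(L₃⁺) = 0`: `red_sharp_ne_zero_of_spanModBy_even_three`, `exists_signed_hasUnitContent_neg_one_of_spanModBy_even_three`);
  ODD HALF ⟹ `L♭ = L⁻ = kobayashiL 1` (`red_flat_ne_zero_of_spanModBy_odd_three`, `exists_signed_hasUnitContent_one_of_spanModBy_odd_three`);
  BOTH HALVES ⟹ every colour `≠ 0`, `μ = 0`, unit content, `μ(Λ/(L^•)) = 0` (`forall_chromaticL_muZero_of_spanModBy_parity_three`),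
  the rider at the pair in the stub's currency (`forall_sign_exists_signed_hasUnitContent_of_spanModBy_parity_three`, via gen 2's
  opposite-parity certificate) and the node (`signedMuVanishing_three_of_spanModBy_parity`).
* §2 (class-wide): LS-0(3) ⟹ PARITY-SPAN(3) (`paritySpanAtThree_of_layeredStevensModAtThree` — the new hypothesis is WEAKER);
  PARITY-SPAN(3) ⟹ the `p = 3` slice of the rider / the node for EVERY curve with good reduction at `3` and `a₃ = 0`
  (`forall_sign_exists_signed_hasUnitContent_three_of_paritySpanAtThree`, `signedMuVanishing_three_of_paritySpanAtThree`);
  EVEN-SPAN(3) alone ⟹ `μ(L₃⁺(E)) = 0`, ODD-SPAN(3) alone ⟹ `μ(L₃⁻(E)) = 0` class-wide (one half = one sign);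
  ASSEMBLY `muBothSigns_of_paritySpanAtThree_of_signedMuVanishing` — the registered stub's TEXT from PARITY-SPAN(3) and the node at
  the `p ≥ 5` pairs of the domain (gen 2's `muBothSigns_of_layeredStevensModAtThree_of_signedMuVanishing` with LS-0(3) replaced by
  PARITY-SPAN(3)); `unionSpanAtThree` — the UNION of the halves spans at every level prime to `3`, input-free (THEOREM B), so
  PARITY-SPAN(3) is exactly the parity splitting of a proved statement.

References: [Sun2007] §4 (8), Conj. 8; [Manin1972] Prop. 1.4; [Vaserstein1972SL2] Theorem; [MazurTateTeitelbaum1986Invent] §I.10 (10.1);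
[Pollack2003] Prop. 6.9–6.10, 6.18; [Sprung2017] §3.1, Cor. 4.10–4.11; [Kobayashi2003] Thm. 3.2, (3.4)–(3.6); [PerrinRiou2003] §6.1
Conj. 6.1.1; [PollackWeston2011] Rem. 4.2; tree: part 4a and parts 1–3 of this seat, x8's `PrintX8MazurTateMuRider` / `…LayeredStevensBridge`.
-/

-- D-0017: single-problem summit, the namespace repeats the problem name by design.
set_option linter.dupNamespace false
set_option autoImplicit false

noncomputable section

open scoped Classical MatrixGroups ModularForm

open CongruenceSubgroup Polynomial WeierstrassCurve Literature.NumberTheory.EllipticCurves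
  Literature.NumberTheory.EllipticCurves.ModularForms
  Literature.NumberTheory.EllipticCurves.Sprung2017
  Literature.NumberTheory.EllipticCurves.Kobayashi2003
  Literature.NumberTheory.EllipticCurves.GreenbergVatsal2000
  Literature.NumberTheory.EllipticCurves.Rank1Residual
  Summit.BirchSwinnertonDyer.Rank1Residual.X1.MuLambda
  Summit.BirchSwinnertonDyer.Rank1Residual.Supersingular
  Summit.BirchSwinnertonDyer.BirchSwinnertonDyer.Theorems.PrintX8MazurTateMuRider
  Summit.BirchSwinnertonDyer.BirchSwinnertonDyer.Theorems.PrintX8MazurTateThreeCollapse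
  Summit.BirchSwinnertonDyer.BirchSwinnertonDyer.Theorems.PrintX8LayeredStevensCollapse
  Summit.BirchSwinnertonDyer.BirchSwinnertonDyer.Theorems.SmallImageLowerHalfBothSignsMuRiderNode
  Summit.BirchSwinnertonDyer.BirchSwinnertonDyer.Theorems.SmallImageLowerHalfBothSignsMuRiderTwoParityLayersThree

namespace Summit.BirchSwinnertonDyer.BirchSwinnertonDyer.Theorems.SmallImageLowerHalfBothSignsMuRiderParitySpanThree

/-! ## §1 `p = 3`, `a₃ = 0`: ONE SIGN PER HALF, both signs and the node from both halves -/

section Three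

variable {W : WeierstrassCurve ℚ} [W.IsElliptic] [W.IsGloballyMinimal] {N : ℕ} [NeZero N]
  {f : CuspForm (Gamma0 N) 2} {p : ℕ} [hp : Fact p.Prime]

/-- **EVEN HALF ⟹ `L♯ ≢ 0 (mod 3)`** for ANY Sprung pair of ANY newform `f` of `W` (`p = 3` good, `a₃ = 0`), the span
hypothesis read at the level of `f`. [cite: Sun2007, §4 (8)] [cite: Pollack2003, Prop. 6.9 and Prop. 6.10] -/
theorem red_sharp_ne_zero_of_spanModBy_even_three (hp3 : p = 3) (hgood : W.HasGoodReductionAtPrime p)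
    (hap0 : W.frobeniusTrace p = 0) (hf : IsNewformOf W f)
    {Lsharp Lflat : IwasawaAlgebra p} (hSP : IsSprungPair f p (W.frobeniusTrace p) Lsharp Lflat)
    (hS : SpanModBy N p {γ : Gamma0 N | IsGoodAt (p ^ 2) γ}) : red Lsharp ≠ 0 := by
  have hp2 : p ≠ 2 := by omega
  have hap1 : ¬ ((p : ℤ) ∣ W.frobeniusTrace p - 1) := by subst hp3; rw [hap0]; norm_num
  obtain ⟨m, b, hm, hb, h⟩ := exists_unit_evenLayer_of_spanModBy W p f hf hp2 hgood hap1 hS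
  exact red_sharp_ne_zero_of_unit_evenLayer_three hp3 hgood hap0 hf hSP (m := 2 * m) (by omega)
    (even_two_mul m) hb h

/-- **ODD HALF ⟹ `L♭ ≢ 0 (mod 3)`** for ANY Sprung pair of ANY newform `f` of `W` (`p = 3` good, `a₃ = 0`).
[cite: Sun2007, §4 (8)] [cite: Pollack2003, Prop. 6.9 and Prop. 6.10] -/
theorem red_flat_ne_zero_of_spanModBy_odd_three (hp3 : p = 3) (hgood : W.HasGoodReductionAtPrime p)
    (hap0 : W.frobeniusTrace p = 0) (hf : IsNewformOf W f)
    {Lsharp Lflat : IwasawaAlgebra p} (hSP : IsSprungPair f p (W.frobeniusTrace p) Lsharp Lflat)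
    (hS : SpanModBy N p {γ : Gamma0 N | ∃ k : ℕ, (dEntry γ).natAbs = p ^ (2 * k + 1)}) : red Lflat ≠ 0 := by
  have hp2 : p ≠ 2 := by omega
  have hap1 : ¬ ((p : ℤ) ∣ W.frobeniusTrace p - 1) := by subst hp3; rw [hap0]; norm_num
  obtain ⟨m, b, hb, h⟩ := exists_unit_oddLayer_of_spanModBy W p f hf hp2 hgood hap1 hS
  exact red_flat_ne_zero_of_unit_oddLayer_three hp3 hgood hap0 hf hSP ⟨m, rfl⟩ hb h

/-- **EVEN HALF ⟹ the sign `ε = −1` of the rider at the pair: `∃ L₀, IsSignedPAdicLFunction f 3 (−1) L₀ ∧ HasUnitContent L₀`**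
(`kobayashiL (−1) L⁺ L⁻ = L⁺ = L♯`; `p = 3` good, `a₃ = 0`, `f` any newform of `W`).
[cite: Kobayashi2003, Thm. 3.2 and (3.4)–(3.6) (p. 7)] [cite: Pollack2003, Prop. 6.18] [cite: Sun2007, §4 (8)] -/
theorem exists_signed_hasUnitContent_neg_one_of_spanModBy_even_three (hp3 : p = 3)
    (hgood : W.HasGoodReductionAtPrime p) (hap0 : W.frobeniusTrace p = 0) (hf : IsNewformOf W f)
    (hS : SpanModBy N p {γ : Gamma0 N | IsGoodAt (p ^ 2) γ}) :
    ∃ L₀ : IwasawaAlgebra p, IsSignedPAdicLFunction f p (-1) L₀ ∧ HasUnitContent L₀ := by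
  have hp2 : p ≠ 2 := by omega
  obtain ⟨Lplus, Lminus, hPP⟩ :=
    exists_isPollackPair pollack_exists_plusMinusPAdicLFunction_holds hp2 hf hgood hap0
  have hSP : IsSprungPair f p (W.frobeniusTrace p) Lplus Lminus := by
    rw [hap0]
    exact (isSprungPair_zero_iff f p Lplus Lminus).mpr ⟨hPP.2.2.1, hPP.2.2.2⟩
  refine ⟨kobayashiL (-1) Lplus Lminus, hPP.isSignedPAdicLFunction_kobayashiL (-1), ?_⟩
  have hne : ((-1 : ℤˣ) = 1) ↔ False := by decide
  rw [kobayashiL, if_neg hne.mp]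
  exact hasUnitContent_of_red_ne_zero (red_sharp_ne_zero_of_spanModBy_even_three hp3 hgood hap0 hf hSP hS)

/-- **ODD HALF ⟹ the sign `ε = 1` of the rider at the pair: `∃ L₀, IsSignedPAdicLFunction f 3 1 L₀ ∧ HasUnitContent L₀`**
(`kobayashiL 1 L⁺ L⁻ = L⁻ = L♭`). [cite: Kobayashi2003, Thm. 3.2 and (3.4)–(3.6) (p. 7)] [cite: Pollack2003, Prop. 6.18] [cite: Sun2007, §4 (8)] -/
theorem exists_signed_hasUnitContent_one_of_spanModBy_odd_three (hp3 : p = 3)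
    (hgood : W.HasGoodReductionAtPrime p) (hap0 : W.frobeniusTrace p = 0) (hf : IsNewformOf W f)
    (hS : SpanModBy N p {γ : Gamma0 N | ∃ k : ℕ, (dEntry γ).natAbs = p ^ (2 * k + 1)}) :
    ∃ L₀ : IwasawaAlgebra p, IsSignedPAdicLFunction f p 1 L₀ ∧ HasUnitContent L₀ := by
  have hp2 : p ≠ 2 := by omega
  obtain ⟨Lplus, Lminus, hPP⟩ :=
    exists_isPollackPair pollack_exists_plusMinusPAdicLFunction_holds hp2 hf hgood hap0
  have hSP : IsSprungPair f p (W.frobeniusTrace p) Lplus Lminus := by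
    rw [hap0]
    exact (isSprungPair_zero_iff f p Lplus Lminus).mpr ⟨hPP.2.2.1, hPP.2.2.2⟩
  refine ⟨kobayashiL 1 Lplus Lminus, hPP.isSignedPAdicLFunction_kobayashiL 1, ?_⟩
  rw [kobayashiL, if_pos rfl]
  exact hasUnitContent_of_red_ne_zero (red_flat_ne_zero_of_spanModBy_odd_three hp3 hgood hap0 hf hSP hS)

/-- **BOTH HALVES ⟹ every colour: `L^• ≠ 0`, `μ(L^•) = 0`, unit content, `μ(Λ/(L^•)) = 0`** (`p = 3` good, `a₃ = 0`, `f` any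
newform, any Sprung pair). [cite: Pollack2003, Prop. 6.9 and Prop. 6.10] [cite: Sprung2017, §3.1 and Cor. 4.10] [cite: Sun2007, §4 (8)] -/
theorem forall_chromaticL_muZero_of_spanModBy_parity_three (hp3 : p = 3) (hgood : W.HasGoodReductionAtPrime p)
    (hap0 : W.frobeniusTrace p = 0) (hf : IsNewformOf W f)
    {Lsharp Lflat : IwasawaAlgebra p} (hSP : IsSprungPair f p (W.frobeniusTrace p) Lsharp Lflat)
    (hSe : SpanModBy N p {γ : Gamma0 N | IsGoodAt (p ^ 2) γ})
    (hSo : SpanModBy N p {γ : Gamma0 N | ∃ k : ℕ, (dEntry γ).natAbs = p ^ (2 * k + 1)}) (c : Chroma) :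
    chromaticL c Lsharp Lflat ≠ 0 ∧ mu (chromaticL c Lsharp Lflat) = 0 ∧
      HasUnitContent (chromaticL c Lsharp Lflat) ∧
      muInvariant p (IwasawaAlgebra p ⧸ Ideal.span {chromaticL c Lsharp Lflat}) = 0 := by
  have hred : red (chromaticL c Lsharp Lflat) ≠ 0 := by
    cases c with
    | sharp =>
      rw [chromaticL_sharp]
      exact red_sharp_ne_zero_of_spanModBy_even_three hp3 hgood hap0 hf hSP hSe
    | flat =>
      rw [chromaticL_flat]
      exact red_flat_ne_zero_of_spanModBy_odd_three hp3 hgood hap0 hf hSP hSo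
  exact ⟨ne_zero_of_red_ne_zero hred, (mu_eq_zero_and_lam_eq_of_red_ne_zero hred).1,
    hasUnitContent_of_red_ne_zero hred, muInvariant_quotient_span_eq_zero_of_red_ne_zero hred⟩

/-- **BOTH HALVES ⟹ the both-signs rider at the pair in the stub's currency** (`p = 3` good, `a₃ = 0`, `f` any newform
of `W`; through gen 2's opposite-parity certificate `forall_sign_exists_signed_hasUnitContent_of_twoParityLayers_three`).
[cite: Kobayashi2003, Thm. 3.2 and (3.4)–(3.6) (p. 7)] [cite: Pollack2003, Prop. 6.18] [cite: Sun2007, §4 (8)] -/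
theorem forall_sign_exists_signed_hasUnitContent_of_spanModBy_parity_three (hp3 : p = 3)
    (hgood : W.HasGoodReductionAtPrime p) (hap0 : W.frobeniusTrace p = 0) (hf : IsNewformOf W f)
    (hSe : SpanModBy N p {γ : Gamma0 N | IsGoodAt (p ^ 2) γ})
    (hSo : SpanModBy N p {γ : Gamma0 N | ∃ k : ℕ, (dEntry γ).natAbs = p ^ (2 * k + 1)}) (ε : ℤˣ) :
    ∃ L₀ : IwasawaAlgebra p, IsSignedPAdicLFunction f p ε L₀ ∧ HasUnitContent L₀ := by
  have hp2 : p ≠ 2 := by omega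
  have hap1 : ¬ ((p : ℤ) ∣ W.frobeniusTrace p - 1) := by subst hp3; rw [hap0]; norm_num
  obtain ⟨m₁, b₁, hm₁, hb₁, h1⟩ := exists_unit_evenLayer_of_spanModBy W p f hf hp2 hgood hap1 hSe
  obtain ⟨m₂, b₂, hb₂, h2⟩ := exists_unit_oddLayer_of_spanModBy W p f hf hp2 hgood hap1 hSo
  exact forall_sign_exists_signed_hasUnitContent_of_twoParityLayers_three hp3 hgood hap0 hf (m₁ := 2 * m₁)
    (m₂ := 2 * m₂ + 1) (by omega) (by omega) ⟨m₁ + m₂, by ring⟩ hb₁ hb₂ h1 h2 ε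

/-- **BOTH HALVES at the conductor level ⟹ the node `SignedMuVanishing W 3`** (`a₃ = 0`; the span hypotheses are read at the
level of each newform of `W`, i.e. at the conductor, `3 ∤ N_E`). [cite: PerrinRiou2003, §6.1 Conjecture 6.1.1] [cite: Sun2007, §4 Conj. 8] -/
theorem signedMuVanishing_three_of_spanModBy_parity (hp3 : p = 3) (hgood : W.HasGoodReductionAtPrime p)
    (hap0 : W.frobeniusTrace p = 0)
    (hS : ∀ {M : ℕ} [NeZero M] (g : CuspForm (Gamma0 M) 2), IsNewformOf W g →
      SpanModBy M p {γ : Gamma0 M | IsGoodAt (p ^ 2) γ} ∧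
        SpanModBy M p {γ : Gamma0 M | ∃ k : ℕ, (dEntry γ).natAbs = p ^ (2 * k + 1)}) :
    SignedMuVanishing W p := by
  intro hN f₀ hf₀ Lsharp Lflat hSP c
  haveI := hN
  obtain ⟨hSe, hSo⟩ := hS f₀ hf₀
  obtain ⟨hne, hmu, -, -⟩ :=
    forall_chromaticL_muZero_of_spanModBy_parity_three hp3 hgood hap0 hf₀ hSP hSe hSo c
  exact ⟨hne, hmu⟩

end Three

/-! ## §2 Class-wide: PARITY-SPAN(3) replaces LS-0(3) in gen 2's assembly; one half = one sign -/

section ClassWide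

/-- **LS-0(3) ⟹ PARITY-SPAN(3)** (the new hypothesis is WEAKER than gen 2's): all large layers span ⟹ in particular one even
and one odd layer span ⟹ both halves span (monotonicity).  The converse is not claimed. [cite: Sun2007, §4 Conj. 8] [cite: Manin1972, Prop. 1.4] -/
theorem paritySpanAtThree_of_layeredStevensModAtThree
    (hLSM : ∀ M : ℕ, 0 < M → ¬ 3 ∣ M → ∃ m₀ : ℕ, ∀ m : ℕ, m₀ ≤ m → LayerEisSpanModGen M 3 m) :
    ∀ M : ℕ, 0 < M → ¬ 3 ∣ M →
      SpanModBy M 3 {γ : Gamma0 M | IsGoodAt (3 ^ 2) γ} ∧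
        SpanModBy M 3 {γ : Gamma0 M | ∃ k : ℕ, (dEntry γ).natAbs = 3 ^ (2 * k + 1)} := by
  intro M hM h3M
  obtain ⟨m₀, hm₀⟩ := hLSM M hM h3M
  exact spanModBy_parity_of_layerEisSpanTwoModGen ⟨m₀ + 1, by omega, hm₀ _ (by omega), hm₀ _ (by omega)⟩

/-- **PARITY-SPAN(3) ⟹ the `p = 3` slice of the both-signs rider for EVERY curve with good reduction at `3` and `a₃ = 0`**
(no class / CM / image hypothesis; in particular at the 100 `p = 3` pairs of child L's census).  PARITY-SPAN(3) = «for every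
level `M ≥ 1` prime to `3`, the even-layer classes span AND the odd-layer classes span, mod `3`, up to the Eisenstein part» —
OPEN (implied by Sun 2007 Conj. 8 at `(3,3)` / LS-0(3); a HYPOTHESIS here). [cite: Sun2007, §4 Conj. 8] [cite: PerrinRiou2003, §6.1 Conjecture 6.1.1] -/
theorem forall_sign_exists_signed_hasUnitContent_three_of_paritySpanAtThree
    (hPS : ∀ M : ℕ, 0 < M → ¬ 3 ∣ M →
      SpanModBy M 3 {γ : Gamma0 M | IsGoodAt (3 ^ 2) γ} ∧
        SpanModBy M 3 {γ : Gamma0 M | ∃ k : ℕ, (dEntry γ).natAbs = 3 ^ (2 * k + 1)})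
    (W : WeierstrassCurve ℚ) [W.IsElliptic] [W.IsGloballyMinimal] (p : ℕ) [Fact p.Prime] (hp3 : p = 3)
    (hgood : W.HasGoodReductionAtPrime p) (hap0 : W.frobeniusTrace p = 0)
    {N : ℕ} [NeZero N] {f : CuspForm (Gamma0 N) 2} (hf : IsNewformOf W f) (ε : ℤˣ) :
    ∃ L₀ : IwasawaAlgebra p, IsSignedPAdicLFunction f p ε L₀ ∧ HasUnitContent L₀ := by
  subst hp3
  obtain ⟨hSe, hSo⟩ := hPS N (Nat.pos_of_ne_zero (NeZero.ne N)) (not_dvd_level_of_isNewformOf hf hgood)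
  exact forall_sign_exists_signed_hasUnitContent_of_spanModBy_parity_three rfl hgood hap0 hf hSe hSo ε

/-- **PARITY-SPAN(3) ⟹ `SignedMuVanishing W 3` for every curve with good reduction at `3` and `a₃ = 0`.**
[cite: Sun2007, §4 Conj. 8] [cite: PerrinRiou2003, §6.1 Conjecture 6.1.1] -/
theorem signedMuVanishing_three_of_paritySpanAtThree
    (hPS : ∀ M : ℕ, 0 < M → ¬ 3 ∣ M →
      SpanModBy M 3 {γ : Gamma0 M | IsGoodAt (3 ^ 2) γ} ∧
        SpanModBy M 3 {γ : Gamma0 M | ∃ k : ℕ, (dEntry γ).natAbs = 3 ^ (2 * k + 1)})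
    (W : WeierstrassCurve ℚ) [W.IsElliptic] [W.IsGloballyMinimal] (p : ℕ) [Fact p.Prime] (hp3 : p = 3)
    (hgood : W.HasGoodReductionAtPrime p) (hap0 : W.frobeniusTrace p = 0) : SignedMuVanishing W p := by
  subst hp3
  refine signedMuVanishing_three_of_spanModBy_parity rfl hgood hap0 fun {M} _ g hg ↦ ?_
  exact hPS M (Nat.pos_of_ne_zero (NeZero.ne M)) (not_dvd_level_of_isNewformOf hg hgood)

/-- **EVEN-SPAN(3) alone ⟹ `μ(L₃⁺(E)) = 0` (sign `ε = −1`) for every curve with good reduction at `3` and `a₃ = 0`** — one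
parity half of THEOREM B's conclusion is worth exactly one sign, class-wide. [cite: Sun2007, §4 Conj. 8] [cite: PollackWeston2011, Rem. 4.2] -/
theorem exists_signed_hasUnitContent_neg_one_three_of_evenSpanAtThree
    (hES : ∀ M : ℕ, 0 < M → ¬ 3 ∣ M → SpanModBy M 3 {γ : Gamma0 M | IsGoodAt (3 ^ 2) γ})
    (W : WeierstrassCurve ℚ) [W.IsElliptic] [W.IsGloballyMinimal] (p : ℕ) [Fact p.Prime] (hp3 : p = 3)
    (hgood : W.HasGoodReductionAtPrime p) (hap0 : W.frobeniusTrace p = 0)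
    {N : ℕ} [NeZero N] {f : CuspForm (Gamma0 N) 2} (hf : IsNewformOf W f) :
    ∃ L₀ : IwasawaAlgebra p, IsSignedPAdicLFunction f p (-1) L₀ ∧ HasUnitContent L₀ := by
  subst hp3
  exact exists_signed_hasUnitContent_neg_one_of_spanModBy_even_three rfl hgood hap0 hf
    (hES N (Nat.pos_of_ne_zero (NeZero.ne N)) (not_dvd_level_of_isNewformOf hf hgood))

/-- **ODD-SPAN(3) alone ⟹ `μ(L₃⁻(E)) = 0` (sign `ε = 1`) for every curve with good reduction at `3` and `a₃ = 0`.**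
[cite: Sun2007, §4 Conj. 8] [cite: PollackWeston2011, Rem. 4.2] -/
theorem exists_signed_hasUnitContent_one_three_of_oddSpanAtThree
    (hOS : ∀ M : ℕ, 0 < M → ¬ 3 ∣ M → SpanModBy M 3 {γ : Gamma0 M | ∃ k : ℕ, (dEntry γ).natAbs = 3 ^ (2 * k + 1)})
    (W : WeierstrassCurve ℚ) [W.IsElliptic] [W.IsGloballyMinimal] (p : ℕ) [Fact p.Prime] (hp3 : p = 3)
    (hgood : W.HasGoodReductionAtPrime p) (hap0 : W.frobeniusTrace p = 0)
    {N : ℕ} [NeZero N] {f : CuspForm (Gamma0 N) 2} (hf : IsNewformOf W f) :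
    ∃ L₀ : IwasawaAlgebra p, IsSignedPAdicLFunction f p 1 L₀ ∧ HasUnitContent L₀ := by
  subst hp3
  exact exists_signed_hasUnitContent_one_of_spanModBy_odd_three rfl hgood hap0 hf
    (hOS N (Nat.pos_of_ne_zero (NeZero.ne N)) (not_dvd_level_of_isNewformOf hf hgood))

/-- **ASSEMBLY: the registered stub's TEXT (`stub_muBothSigns_ns` of line `birth_acns` v14) from PARITY-SPAN(3) and the node
at the `p ≥ 5` pairs of the domain** — gen 2's `muBothSigns_of_layeredStevensModAtThree_of_signedMuVanishing` with LS-0(3)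
replaced by the WEAKER PARITY-SPAN(3).  The `p ≥ 5` pairs carry the node itself (one sign ⟸ B⁰ `TeichSpanGenAll`; the second
would need a Teichmüller-averaged parity span, no vocabulary in the tree). [cite: Sun2007, §4 Conj. 8]
[cite: PerrinRiou2003, §6.1 Conjecture 6.1.1] [cite: PollackWeston2011, Rem. 4.2] -/
theorem muBothSigns_of_paritySpanAtThree_of_signedMuVanishing
    (hPS : ∀ M : ℕ, 0 < M → ¬ 3 ∣ M →
      SpanModBy M 3 {γ : Gamma0 M | IsGoodAt (3 ^ 2) γ} ∧
        SpanModBy M 3 {γ : Gamma0 M | ∃ k : ℕ, (dEntry γ).natAbs = 3 ^ (2 * k + 1)})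
    (h5 : ∀ (W : WeierstrassCurve ℚ) [W.IsElliptic] [W.IsGloballyMinimal] (p : ℕ) [Fact p.Prime],
      5 ≤ p → ClassX7 W p → ¬ W.HasCM → W.frobeniusTrace p = 0 → ¬ Surj W p → SignedMuVanishing W p) :
    ∀ (W : WeierstrassCurve ℚ) [W.IsElliptic] [W.IsGloballyMinimal] (p : ℕ) [Fact p.Prime],
      p ≠ 2 → ClassX7 W p → ¬ W.HasCM → W.frobeniusTrace p = 0 → ¬ Surj W p →
      ∀ [NeZero (W.conductorNorm ℤ)] (f : CuspForm (Gamma0 (W.conductorNorm ℤ)) 2),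
      IsNewformOf W f → ∀ ε : ℤˣ, ∃ L₀ : IwasawaAlgebra p,
        IsSignedPAdicLFunction f p ε L₀ ∧ HasUnitContent L₀ := by
  intro W _ _ p _ hp2 hX hCM hap hs _ f hf ε
  by_cases hp3 : p = 3
  · exact forall_sign_exists_signed_hasUnitContent_three_of_paritySpanAtThree hPS W p hp3 hX.1.1 hap hf ε
  · have hpP : p.Prime := Fact.out
    have hp5 : 5 ≤ p := hpP.five_le_of_ne_two_of_ne_three hp2 hp3
    exact forall_sign_exists_signed_hasUnitContent_of_signedMuVanishing (h5 W p hp5 hX hCM hap hs) hp2 hX.1.1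
      hap hf ε

/-- **SANITY LINK (THEOREM B is the union): at every level `M` prime to `3` the UNION of the two halves spans, input-free**
— so PARITY-SPAN(3) is exactly the splitting of a proved statement into its parity halves. [cite: Vaserstein1972SL2, Theorem (p. 313)] [cite: Manin1972, Prop. 1.4] -/
theorem unionSpanAtThree (M : ℕ) (h3M : ¬ 3 ∣ M) :
    SpanModBy M 3 ({γ : Gamma0 M | IsGoodAt (3 ^ 2) γ} ∪
      {γ : Gamma0 M | ∃ m : ℕ, (dEntry γ).natAbs = 3 ^ (2 * m + 1)}) :=
  spanModBy_union_parity Nat.prime_three h3M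

end ClassWide

end Summit.BirchSwinnertonDyer.BirchSwinnertonDyer.Theorems.SmallImageLowerHalfBothSignsMuRiderParitySpanThree

end
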